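import Literature.MathematicalPhysics.QuantumManyBody.DyadicCoherentFractionRefinement
import Mathlib.MeasureTheory.Integral.Lebesgue.DominatedConvergence
import Mathlib.Topology.UniformSpace.HeineCantor
import Mathlib.Analysis.Normed.Group.Bounded
import HarnessLib

/-!
# Dyadic coherent fraction: `cohSum N L k Ψ → N` along the dyadic filtration

Topic `Literature/MathematicalPhysics/QuantumManyBody`; third file of the definition item
`defn-DyadicCoherentFraction` (after `DyadicCoherentFraction.lean`, `DyadicCoherentFractionRefinement.lean`).

Main result `tendsto_cohSum_atTop`: for every admissible trial state `Ψ : TrialState N L`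
(`C¹`, Dirichlet, normalised), `cohSum N L k Ψ.ψ → N` as `k → ∞`, i.e. the dyadic coherent fraction
`F_k(Ψ) = cohSum / N` increases to `1`: at fine scales every particle is in the flat mode of its own cell.
Together with `F_0 =` condensate fraction and refinement monotonicity this makes `k ↦ F_k` a
scale-resolved interpolation between BEC and triviality.

Proof (all [folklore]): write `cohSum (n+1) L k Ψ = (n+1) ∫ (∑_m (s³)⁻¹ |∫_{C_m} Ψ(x,Y) dx|²) dY`
(`cohSum_succ_eq`); for each slice `Y` the real cell sums converge to `∫ |Ψ(x,Y)|² dx`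
(`tendsto_cellSum_slice`) by uniform continuity of the compactly supported `Ψ`
(`TrialState.hasCompactSupport`, Heine–Cantor) and the one-level oscillation estimate
`|∫ ‖f‖² − ∑_m (s³)⁻¹ ‖∫_{C_m} f‖²| ≤ 2 M ε L³` (`abs_integral_normSq_sub_cellSum_le`: a function within
`ε` of its cell averages, `norm_sub_cellAverage_le`, the `8^k` cells of total volume `L³` carrying all
of `∫ ‖f‖²`); dominated convergence in `Y` with the Bessel bound per slice
(`sum_nnnorm_cellAverage_sq_le`) as dominating function of integral `∫ |Ψ|² = 1` (Tonelli,
`lintegral_nnnorm_sq_eq_lintegral_vecCons`).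

Also: `dist_lt_of_mem_dyCell` (cells have diameter `< 2 s`), `box_subset_closedBall`,
`dist_vecCons_vecCons` (prepending a particle is an isometry).

## References

* [LSSY2005] E. H. Lieb, R. Seiringer, J. P. Solovej, J. Yngvason, *The Mathematics of the Bose Gas and
  its Condensation*, Birkhäuser 2005, §1.2 (1.17).
-/

noncomputable section

open MeasureTheory Filter Metric WithLp Topology
open scoped ENNReal NNReal ComplexConjugate

namespace Literature.MathematicalPhysics.QuantumManyBody.BoseGas

/-! ### Convergence `cohSum N L k Ψ → N` along the dyadic filtration -/

section Limit

variable {L : ℝ}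

/-- Two points of one cell are closer than twice its side. [folklore] -/
theorem dist_lt_of_mem_dyCell {k : ℕ} {m : Fin 3 → Fin (2 ^ k)} {x y : Space}
    (hx : x ∈ dyCell L k m) (hy : y ∈ dyCell L k m) : dist x y < 2 * (L / 2 ^ k) := by
  have hs : 0 < L / 2 ^ k := by obtain ⟨h1, h2⟩ := hx 0; nlinarith
  have hco : ∀ j, dist (x j) (y j) ^ 2 < (L / 2 ^ k) ^ 2 := fun j => by
    obtain ⟨hx1, hx2⟩ := hx j
    obtain ⟨hy1, hy2⟩ := hy j
    have h : |x j - y j| < L / 2 ^ k := by rw [abs_sub_lt_iff]; constructor <;> linarith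
    rw [Real.dist_eq, sq_lt_sq, abs_abs, abs_of_pos hs]
    exact h
  rw [EuclideanSpace.dist_eq, Real.sqrt_lt' (by positivity)]
  calc ∑ j, dist (x j) (y j) ^ 2 < ∑ _j : Fin 3, (L / 2 ^ k) ^ 2 :=
        Finset.sum_lt_sum_of_nonempty Finset.univ_nonempty fun j _ => hco j
    _ = 3 * (L / 2 ^ k) ^ 2 := by simp
    _ ≤ (2 * (L / 2 ^ k)) ^ 2 := by nlinarith

/-- The real volume of a cell (`L > 0`). [folklore] -/
theorem volume_real_dyCell (hL : 0 < L) (k : ℕ) (m : Fin 3 → Fin (2 ^ k)) :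
    volume.real (dyCell L k m) = (L / 2 ^ k) ^ 3 := by
  rw [measureReal_def, volume_dyCell, ← ENNReal.ofReal_pow (by positivity),
    ENNReal.toReal_ofReal (by positivity)]

/-- Cells have finite volume. [folklore] -/
theorem volume_dyCell_lt_top (L : ℝ) (k : ℕ) (m : Fin 3 → Fin (2 ^ k)) : volume (dyCell L k m) < ∞ := by
  rw [volume_dyCell]
  exact ENNReal.pow_lt_top ENNReal.ofReal_lt_top

/-- If `f` oscillates by at most `ε` on a cell, it is within `ε` of its cell average there. [folklore] -/
theorem norm_sub_cellAverage_le (hL : 0 < L) {k : ℕ} {m : Fin 3 → Fin (2 ^ k)} {f : Space → ℂ}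
    (hfi : IntegrableOn f (dyCell L k m)) {ε : ℝ}
    (hmod : ∀ x ∈ dyCell L k m, ∀ y ∈ dyCell L k m, ‖f x - f y‖ ≤ ε) {x : Space}
    (hx : x ∈ dyCell L k m) :
    ‖f x - (((L / 2 ^ k) ^ 3)⁻¹ : ℝ) • ∫ y in dyCell L k m, f y‖ ≤ ε := by
  have hvolR := volume_real_dyCell hL k m
  have hfin := volume_dyCell_lt_top L k m
  have key : f x - (((L / 2 ^ k) ^ 3)⁻¹ : ℝ) • ∫ y in dyCell L k m, f y =
      (((L / 2 ^ k) ^ 3)⁻¹ : ℝ) • ∫ y in dyCell L k m, (f x - f y) := by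
    rw [integral_sub (integrableOn_const (C := f x) hfin.ne) hfi, setIntegral_const, hvolR, smul_sub,
      smul_smul,
      inv_mul_cancel₀ (by positivity), one_smul]
  rw [key, norm_smul, Real.norm_of_nonneg (by positivity)]
  calc ((L / 2 ^ k) ^ 3)⁻¹ * ‖∫ y in dyCell L k m, (f x - f y)‖
      ≤ ((L / 2 ^ k) ^ 3)⁻¹ * (ε * volume.real (dyCell L k m)) := by
        gcongr
        exact norm_setIntegral_le_of_norm_le_const hfin fun y hy => hmod x hx y hy
    _ = ε := by rw [hvolR]; field_simp

/-- **One-level oscillation estimate.** For a continuous `f` vanishing off the open box, bounded by `M`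
and oscillating by at most `ε` on every cell of level `k`:
`|∫ ‖f‖² − ∑_m (s³)⁻¹ ‖∫_{C_m} f‖²| ≤ 2 M ε L³` (`s = L/2^k`; the `8^k` cells have total volume `L³`).
[folklore] -/
theorem abs_integral_normSq_sub_cellSum_le (hL : 0 < L) (k : ℕ) {f : Space → ℂ} (hf : Continuous f)
    (hzero : ∀ x ∉ box L, f x = 0) {M ε : ℝ} (hM : ∀ x, ‖f x‖ ≤ M)
    (hmod : ∀ m : Fin 3 → Fin (2 ^ k), ∀ x ∈ dyCell L k m, ∀ y ∈ dyCell L k m, ‖f x - f y‖ ≤ ε) :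
    |(∫ x, ‖f x‖ ^ 2) - ∑ m : Fin 3 → Fin (2 ^ k), ((L / 2 ^ k) ^ 3)⁻¹ * ‖∫ x in dyCell L k m, f x‖ ^ 2|
      ≤ 2 * M * ε * L ^ 3 := by
  have hs : 0 < L / 2 ^ k := by positivity
  have hM0 : 0 ≤ M := (norm_nonneg _).trans (hM 0)
  have hvolR := volume_real_dyCell hL k
  have hfin := volume_dyCell_lt_top L k
  have hfi : ∀ m : Fin 3 → Fin (2 ^ k), IntegrableOn f (dyCell L k m) := fun m =>
    Measure.integrableOn_of_bounded (hfin m).ne hf.aestronglyMeasurable (ae_of_all _ fun x => hM x)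
  have hf2i : ∀ m : Fin 3 → Fin (2 ^ k), IntegrableOn (fun x => ‖f x‖ ^ 2) (dyCell L k m) := fun m =>
    Measure.integrableOn_of_bounded (hfin m).ne (hf.norm.pow 2).aestronglyMeasurable (M := M ^ 2)
      (ae_of_all _ fun x => by
        rw [Real.norm_eq_abs, abs_pow, abs_norm]
        exact pow_le_pow_left₀ (norm_nonneg _) (hM x) 2)
  -- the cells carry all of `∫ ‖f‖²`
  have h1 : (∫ x, ‖f x‖ ^ 2) = ∑ m : Fin 3 → Fin (2 ^ k), ∫ x in dyCell L k m, ‖f x‖ ^ 2 := by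
    rw [← integral_iUnion_fintype (fun m => measurableSet_dyCell L k m) (pairwise_disjoint_dyCell L k) hf2i,
      setIntegral_eq_integral_of_forall_compl_eq_zero]
    intro x hx
    have hx' : x ∉ box L := fun h => hx (box_subset_iUnion_dyCell L k h)
    simp [hzero x hx']
  -- per cell
  have h2 : ∀ m : Fin 3 → Fin (2 ^ k), |(∫ x in dyCell L k m, ‖f x‖ ^ 2) -
      ((L / 2 ^ k) ^ 3)⁻¹ * ‖∫ x in dyCell L k m, f x‖ ^ 2| ≤ 2 * M * ε * (L / 2 ^ k) ^ 3 := by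
    intro m
    have hε : 0 ≤ ε := by
      obtain ⟨x, hx⟩ : (dyCell L k m).Nonempty := by
        refine ⟨WithLp.toLp 2 fun j => ((m j : ℕ) : ℝ) * (L / 2 ^ k), fun j => ⟨?_, ?_⟩⟩ <;> simp [hs]
      simpa using hmod m x hx x hx
    set a : ℂ := (((L / 2 ^ k) ^ 3)⁻¹ : ℝ) • ∫ y in dyCell L k m, f y with ha_def
    have hI : ((L / 2 ^ k) ^ 3)⁻¹ * ‖∫ x in dyCell L k m, f x‖ ^ 2 = ∫ _x in dyCell L k m, ‖a‖ ^ 2 := by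
      rw [setIntegral_const, smul_eq_mul, hvolR, ha_def, norm_smul, Real.norm_of_nonneg (by positivity)]
      field_simp
    have ha : ‖a‖ ≤ M := by
      rw [ha_def, norm_smul, Real.norm_of_nonneg (by positivity)]
      calc ((L / 2 ^ k) ^ 3)⁻¹ * ‖∫ y in dyCell L k m, f y‖
          ≤ ((L / 2 ^ k) ^ 3)⁻¹ * (M * volume.real (dyCell L k m)) := by
            gcongr; exact norm_setIntegral_le_of_norm_le_const (hfin m) fun y _ => hM y
        _ = M := by rw [hvolR]; field_simp
    rw [hI, ← integral_sub (hf2i m) (integrableOn_const (C := ‖a‖ ^ 2) (hfin m).ne)]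
    calc |∫ x in dyCell L k m, (‖f x‖ ^ 2 - ‖a‖ ^ 2)|
        = ‖∫ x in dyCell L k m, (‖f x‖ ^ 2 - ‖a‖ ^ 2)‖ := (Real.norm_eq_abs _).symm
      _ ≤ 2 * M * ε * volume.real (dyCell L k m) := by
          refine norm_setIntegral_le_of_norm_le_const (hfin m) fun x hx => ?_
          rw [Real.norm_eq_abs, sq_sub_sq, abs_mul]
          have h3 : |‖f x‖ - ‖a‖| ≤ ε :=
            (abs_norm_sub_norm_le _ _).trans (norm_sub_cellAverage_le hL (hfi m) (hmod m) hx)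
          have h4 : |‖f x‖ + ‖a‖| ≤ 2 * M := by
            rw [abs_of_nonneg (by positivity)]; linarith [hM x, ha]
          calc |‖f x‖ + ‖a‖| * |‖f x‖ - ‖a‖| ≤ 2 * M * ε :=
                mul_le_mul h4 h3 (abs_nonneg _) (by positivity)
            _ = 2 * M * ε := rfl
      _ = 2 * M * ε * (L / 2 ^ k) ^ 3 := by rw [hvolR]
  -- sum over the `8^k` cells
  have h8 : (8 : ℝ) ^ k = ((2 : ℝ) ^ k) ^ 3 := by rw [← pow_mul, mul_comm, pow_mul]; norm_num
  rw [h1, ← Finset.sum_sub_distrib]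
  calc |∑ m : Fin 3 → Fin (2 ^ k), ((∫ x in dyCell L k m, ‖f x‖ ^ 2) -
        ((L / 2 ^ k) ^ 3)⁻¹ * ‖∫ x in dyCell L k m, f x‖ ^ 2)|
      ≤ ∑ m : Fin 3 → Fin (2 ^ k), |(∫ x in dyCell L k m, ‖f x‖ ^ 2) -
          ((L / 2 ^ k) ^ 3)⁻¹ * ‖∫ x in dyCell L k m, f x‖ ^ 2| := Finset.abs_sum_le_sum_abs _ _
    _ ≤ ∑ _m : Fin 3 → Fin (2 ^ k), 2 * M * ε * (L / 2 ^ k) ^ 3 := Finset.sum_le_sum fun m _ => h2 m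
    _ = 2 * M * ε * L ^ 3 := by
        rw [Finset.sum_const, Finset.card_univ, card_dyIndex, nsmul_eq_mul]
        push_cast
        rw [h8, div_pow]
        field_simp

/-- `∑_m ‖(s³)^{-1/2} ∫_{C_m} f‖₊²` (the level-`k` integrand of `cohSum`) as `ofReal` of a real sum. [folklore] -/
theorem sum_nnnorm_cellAmp_sq_eq_ofReal (hL : 0 < L) (k : ℕ) (f : Space → ℂ) :
    ∑ m : Fin 3 → Fin (2 ^ k), ((‖((Real.sqrt ((L / 2 ^ k) ^ 3))⁻¹ : ℂ) *
        ∫ x in dyCell L k m, f x‖₊ : ℝ≥0∞) ^ 2) =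
      ENNReal.ofReal (∑ m : Fin 3 → Fin (2 ^ k), ((L / 2 ^ k) ^ 3)⁻¹ * ‖∫ x in dyCell L k m, f x‖ ^ 2) := by
  have hs3 : 0 < (L / 2 ^ k) ^ 3 := by positivity
  rw [ENNReal.ofReal_sum_of_nonneg (fun m _ => by positivity)]
  refine Finset.sum_congr rfl fun m _ => ?_
  rw [nnnorm_coe_sq_eq_ofReal, norm_mul, norm_inv, Complex.norm_real, Real.norm_of_nonneg (Real.sqrt_nonneg _),
    mul_pow, inv_pow, Real.sq_sqrt hs3.le]

/-- `∫⁻ ‖f‖₊² = ofReal ∫ ‖f‖²` for square-integrable `f`. [folklore] -/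
theorem lintegral_nnnorm_sq_eq_ofReal {f : Space → ℂ} (hf : Integrable (fun x => (‖f x‖ ^ 2 : ℝ))) :
    ∫⁻ x, (‖f x‖₊ : ℝ≥0∞) ^ 2 = ENNReal.ofReal (∫ x, ‖f x‖ ^ 2) := by
  rw [ofReal_integral_eq_lintegral_ofReal hf (ae_of_all _ fun x => by positivity)]
  simp only [nnnorm_coe_sq_eq_ofReal]

/-- Points of the open box have norm at most `2L`. [folklore] -/
theorem norm_le_two_mul_of_mem_box {x : Space} (hx : x ∈ box L) : ‖x‖ ≤ 2 * L := by
  have hL : 0 < L := (hx 0).1.trans (hx 0).2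
  have h : ∑ i, ‖x i‖ ^ 2 ≤ (2 * L) ^ 2 := by
    calc ∑ i, ‖x i‖ ^ 2 ≤ ∑ _i : Fin 3, L ^ 2 := Finset.sum_le_sum fun i _ => by
          rw [Real.norm_eq_abs, sq_abs]; nlinarith [(hx i).1, (hx i).2]
      _ = 3 * L ^ 2 := by simp
      _ ≤ (2 * L) ^ 2 := by nlinarith
  rw [EuclideanSpace.norm_eq]
  calc √(∑ i, ‖x i‖ ^ 2) ≤ √((2 * L) ^ 2) := Real.sqrt_le_sqrt h
    _ = 2 * L := Real.sqrt_sq (by positivity)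

/-- The open box lies in the closed ball of radius `2L` about the origin (so it is bounded and has
finite volume). [folklore] -/
theorem box_subset_closedBall (L : ℝ) : box L ⊆ Metric.closedBall (0 : Space) (2 * L) := fun x hx => by
  rw [Metric.mem_closedBall, dist_zero_right]
  exact norm_le_two_mul_of_mem_box hx

/-- The `N`-particle box is bounded (sup metric); private copy of the lemma of the same name in
`GroundStateFeynmanKacCompact.lean` (not imported: heavy cone). [folklore] -/
private theorem isBounded_boxN' (N : ℕ) (L : ℝ) : Bornology.IsBounded (boxN N L) :=
  isBounded_iff_forall_norm_le.2 ⟨2 * L ⊔ 0, fun _ hX =>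
    (pi_norm_le_iff_of_nonneg le_sup_right).2 fun i =>
      (norm_le_two_mul_of_mem_box (hX i)).trans le_sup_left⟩

/-- Admissible trial states have compact support. [folklore] -/
theorem TrialState.hasCompactSupport {N : ℕ} (Ψ : TrialState N L) : HasCompactSupport Ψ.ψ :=
  HasCompactSupport.intro (isBounded_boxN' N L).isCompact_closure fun X hX =>
    Ψ.eq_zero X fun h => hX (subset_closure h)

/-- Prepending a particle is an isometry in the particle: `dist (x, Y) (y, Y) = dist x y`. [folklore] -/
theorem dist_vecCons_vecCons {n : ℕ} (x y : Space) (Y : Config n) :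
    dist (Matrix.vecCons x Y : Config (n + 1)) (Matrix.vecCons y Y) = dist x y := by
  have h := Fin.dist_insertNth_insertNth (α := fun _ : Fin (n + 1) => Space) 0 x y Y Y
  rw [Fin.insertNth_zero', Fin.insertNth_zero', dist_self, max_eq_left dist_nonneg] at h
  exact h

/-- `cohSum` for `N = n+1` as one `Y`-integral of the level-`k` cell sum. [folklore] -/
theorem cohSum_succ_eq {n : ℕ} (L : ℝ) (k : ℕ) {Ψ : Config (n + 1) → ℂ} (hΨ : Measurable Ψ) :
    cohSum (n + 1) L k Ψ = (n + 1 : ℝ≥0∞) * ∫⁻ Y : Config n, ∑ m : Fin 3 → Fin (2 ^ k),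
      ((‖((Real.sqrt ((L / 2 ^ k) ^ 3))⁻¹ : ℂ) *
        ∫ x in dyCell L k m, Ψ (Matrix.vecCons x Y)‖₊ : ℝ≥0∞) ^ 2) := by
  have hG : ∀ m : Fin 3 → Fin (2 ^ k), Measurable fun Y : Config n =>
      ((‖((Real.sqrt ((L / 2 ^ k) ^ 3))⁻¹ : ℂ) *
        ∫ x in dyCell L k m, Ψ (Matrix.vecCons x Y)‖₊ : ℝ≥0∞) ^ 2) := fun m =>
    (((measurable_setIntegral_vecCons hΨ _).const_mul _).nnnorm.coe_nnreal_ennreal).pow_const 2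
  simp only [cohSum, occupation_succ, integral_conj_dyMode_mul]
  rw [← Finset.mul_sum, ← lintegral_finsetSum Finset.univ fun m _ => hG m]

/-- **Slice convergence.** For an admissible trial state and every `Y`, the level-`k` cell sums of the
slice `x ↦ Ψ(x, Y)` converge to `∫ |Ψ(x, Y)|² dx` (uniform continuity of `Ψ` and the one-level
oscillation estimate). [folklore] -/
theorem tendsto_cellSum_slice {n : ℕ} (hL : 0 < L) (Ψ : TrialState (n + 1) L) (Y : Config n) :
    Tendsto (fun k => ∑ m : Fin 3 → Fin (2 ^ k), ((L / 2 ^ k) ^ 3)⁻¹ *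
        ‖∫ x in dyCell L k m, Ψ.ψ (Matrix.vecCons x Y)‖ ^ 2) atTop
      (𝓝 (∫ x, ‖Ψ.ψ (Matrix.vecCons x Y)‖ ^ 2)) := by
  set f : Space → ℂ := fun x => Ψ.ψ (Matrix.vecCons x Y) with hf_def
  have hcont : Continuous Ψ.ψ := Ψ.contDiff.continuous
  have hfc : Continuous f := hcont.comp (continuous_id.matrixVecCons continuous_const)
  have hzero : ∀ x ∉ box L, f x = 0 := fun x hx =>
    Ψ.eq_zero _ fun h => hx (by simpa using h 0)
  obtain ⟨M, hM⟩ := Ψ.hasCompactSupport.exists_bound_of_continuous hcont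
  have hM0 : 0 ≤ M := (norm_nonneg _).trans (hM 0)
  have hUC := Ψ.hasCompactSupport.uniformContinuous_of_continuous hcont
  rw [Metric.tendsto_atTop]
  intro ε' hε'
  set ε : ℝ := ε' / (2 * M * L ^ 3 + 1) with hε_def
  have hden : 0 < 2 * M * L ^ 3 + 1 := by positivity
  have hε : 0 < ε := div_pos hε' hden
  obtain ⟨η, hη, hmodΨ⟩ := Metric.uniformContinuous_iff.1 hUC ε hε
  -- choose the level: `2 L / 2^k < η`
  obtain ⟨k₀, hk₀⟩ := exists_pow_lt_of_lt_one (div_pos hη (by positivity : (0 : ℝ) < 2 * L))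
    (by norm_num : (1 / 2 : ℝ) < 1)
  refine ⟨k₀, fun k hk => ?_⟩
  have hside : 2 * (L / 2 ^ k) < η := by
    have h1 : (1 / 2 : ℝ) ^ k ≤ (1 / 2) ^ k₀ := pow_le_pow_of_le_one (by norm_num) (by norm_num) hk
    have h2 : 2 * (L / 2 ^ k) = 2 * L * (1 / 2) ^ k := by rw [one_div, inv_pow]; ring
    rw [h2]
    calc 2 * L * (1 / 2) ^ k ≤ 2 * L * (1 / 2) ^ k₀ := by gcongr
      _ < 2 * L * (η / (2 * L)) := by gcongr
      _ = η := by field_simp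
  have hmod : ∀ m : Fin 3 → Fin (2 ^ k), ∀ x ∈ dyCell L k m, ∀ y ∈ dyCell L k m, ‖f x - f y‖ ≤ ε := by
    intro m x hx y hy
    have hd : dist (Matrix.vecCons x Y : Config (n + 1)) (Matrix.vecCons y Y) < η := by
      rw [dist_vecCons_vecCons]; exact (dist_lt_of_mem_dyCell hx hy).trans hside
    have := hmodΨ hd
    rw [dist_eq_norm] at this
    exact this.le
  have hest := abs_integral_normSq_sub_cellSum_le hL k hfc hzero (fun x => hM _) hmod
  rw [Real.dist_eq, abs_sub_comm]
  calc |(∫ x, ‖f x‖ ^ 2) - ∑ m : Fin 3 → Fin (2 ^ k), ((L / 2 ^ k) ^ 3)⁻¹ * ‖∫ x in dyCell L k m, f x‖ ^ 2|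
      ≤ 2 * M * ε * L ^ 3 := hest
    _ < ε' := by
        rw [hε_def]
        rw [show 2 * M * (ε' / (2 * M * L ^ 3 + 1)) * L ^ 3 = ε' * (2 * M * L ^ 3 / (2 * M * L ^ 3 + 1)) by
          field_simp]
        calc ε' * (2 * M * L ^ 3 / (2 * M * L ^ 3 + 1)) < ε' * 1 := by
              gcongr; rw [div_lt_one hden]; linarith
          _ = ε' := mul_one _

/-- **Convergence of the dyadic coherent sum.** For an admissible trial state,
`cohSum N L k Ψ → N` as `k → ∞`: along the dyadic filtration the flat-mode content of every slice
increases to its full `L²` mass (Lebesgue differentiation for continuous functions), and dominated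
convergence in `Y` (bound: the Bessel inequality per slice) gives `F_k(Ψ) → 1`. [folklore] -/
theorem tendsto_cohSum_atTop {N : ℕ} (Ψ : TrialState N L) :
    Tendsto (fun k => cohSum N L k Ψ.ψ) atTop (𝓝 (N : ℝ≥0∞)) := by
  cases N with
  | zero => simp
  | succ n =>
    have hL : 0 < L := by
      by_contra hL
      have h0 : ∀ X, Ψ.ψ X = 0 := fun X => Ψ.eq_zero X fun hX => hL ((hX 0 0).1.trans (hX 0 0).2)
      have h1 := Ψ.norm_eq
      simp [h0] at h1
    have hcont : Continuous Ψ.ψ := Ψ.contDiff.continuous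
    have hΨm : Measurable Ψ.ψ := hcont.measurable
    -- the slices and their real cell sums
    have hslice_int : ∀ Y : Config n,
        Integrable (fun x : Space => (‖Ψ.ψ (Matrix.vecCons x Y)‖ ^ 2 : ℝ)) := by
      intro Y
      have hfc : Continuous fun x : Space => Ψ.ψ (Matrix.vecCons x Y) :=
        hcont.comp (continuous_id.matrixVecCons continuous_const)
      have hzero : ∀ x ∉ box L, Ψ.ψ (Matrix.vecCons x Y) = 0 := fun x hx =>
        Ψ.eq_zero _ fun h => hx (by simpa using h 0)
      obtain ⟨M, hM⟩ := Ψ.hasCompactSupport.exists_bound_of_continuous hcont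
      refine IntegrableOn.integrable_of_forall_notMem_eq_zero (s := box L) ?_ fun x hx => by
        simp [hzero x hx]
      exact Measure.integrableOn_of_bounded
        (Metric.isBounded_closedBall.subset (box_subset_closedBall L)).measure_lt_top.ne
        (hfc.norm.pow 2).aestronglyMeasurable (M := M ^ 2) (ae_of_all _ fun x => by
          rw [Real.norm_eq_abs, abs_pow, abs_norm]
          exact pow_le_pow_left₀ (norm_nonneg _) (hM _) 2)
    have key : Tendsto (fun k => ∫⁻ Y : Config n, ∑ m : Fin 3 → Fin (2 ^ k),
        ((‖((Real.sqrt ((L / 2 ^ k) ^ 3))⁻¹ : ℂ) *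
          ∫ x in dyCell L k m, Ψ.ψ (Matrix.vecCons x Y)‖₊ : ℝ≥0∞) ^ 2)) atTop
        (𝓝 (∫⁻ Y : Config n, ∫⁻ x : Space, (‖Ψ.ψ (Matrix.vecCons x Y)‖₊ : ℝ≥0∞) ^ 2)) := by
      refine tendsto_lintegral_of_dominated_convergence
        (fun Y : Config n => ∫⁻ x : Space, (‖Ψ.ψ (Matrix.vecCons x Y)‖₊ : ℝ≥0∞) ^ 2)
        (fun k => Finset.measurable_sum _ fun m _ =>
          (((measurable_setIntegral_vecCons hΨm _).const_mul _).nnnorm.coe_nnreal_ennreal).pow_const 2)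
        (fun k => ae_of_all _ fun Y => sum_nnnorm_cellAverage_sq_le hL k hΨm Y) ?_
        (ae_of_all _ fun Y => ?_)
      · rw [← lintegral_nnnorm_sq_eq_lintegral_vecCons hΨm, Ψ.norm_eq]
        exact ENNReal.one_ne_top
      · simp only [sum_nnnorm_cellAmp_sq_eq_ofReal hL, lintegral_nnnorm_sq_eq_ofReal (hslice_int Y)]
        exact ENNReal.tendsto_ofReal (tendsto_cellSum_slice hL Ψ Y)
    have hlim : ∫⁻ Y : Config n, ∫⁻ x : Space, (‖Ψ.ψ (Matrix.vecCons x Y)‖₊ : ℝ≥0∞) ^ 2 = 1 := by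
      rw [← lintegral_nnnorm_sq_eq_lintegral_vecCons hΨm, Ψ.norm_eq]
    rw [hlim] at key
    have := ENNReal.Tendsto.const_mul key (Or.inl one_ne_zero) (a := (n + 1 : ℝ≥0∞))
    simp only [mul_one] at this
    simp only [cohSum_succ_eq L _ hΨm]
    convert this using 2
    push_cast
    rfl

end Limit

end Literature.MathematicalPhysics.QuantumManyBody.BoseGas

end
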